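import Mathlib
import HarnessLib
import Summits.HubbardSuperconductivity.HubbardSuperconductivity.Theorems.KLProgrammeSWaveCascadeAllScales

/-!
# Route `KLProgramme` — row 0′ (child 1): the repulsive scalar cascade in CLOSED FORM, `1/U_n = 1/U_0 + Σ_{j<n} W_j`, and its Lipschitz dependence on the net masses
# (the comparison sequence of (B1-V) is `u_j(Qm) = U/(1 + U·Σ_{i<j} W_i(Qm))`; two transfers with close net masses have close comparison sequences)

Cell gate-hubbard-kl, seat hubbard-kl-k3c1-p1 (g19; child-1 lineage; technique «composed-map remainder propagation» — `klcrf_compose/lipschitz_weighted` in cascade form).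
Sequel to `…SWaveCascadeAllScales` §1 (p701157).  The cascade `U_{n+1} = U_n/(1 + W_n U_n)` is a composition of Möbius maps and is EXACTLY SOLVABLE: as long as the
denominators are positive, `U_{n+1}⁻¹ = U_n⁻¹ + W_n`, so **`(U_n)⁻¹ = (U_0)⁻¹ + Σ_{j<n} W_j`** (**`sWaveCascade_inv_eq`**) and **`U_n = U_0/(1 + U_0·Σ_{j<n} W_j)`**
(**`sWaveCascade_eq_div`**; under the negative-mass floor of `…SWaveCascadeEdgeAlgebra` for every `n ≤ N`, `U_0 = 0` included: **`sWaveFloor_eq_div`**).  Consequently two cascades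
from the same `U_0` with net masses `W`, `W'` satisfy the EXACT comparison identity **`U_n − U'_n = U_n·U'_n·Σ_{j<n}(W'_j − W_j)`** (**`sWaveFloor_sub_eq`**) and the Lipschitz bound
**`|U_n − U'_n| ≤ (16U_0/15)²·|Σ_{j<n}(W_j − W'_j)| ≤ (16U_0/15)²·Σ_{j<n}|W_j − W'_j|`** (**`sWaveFloor_sub_le`**, **`sWaveFloor_sub_le'`**).  Use (pen g25 (R386), k3c2-p3 g16's
(T2) hypothesis (s2) «SUP-VS-PIN»): the (B1-V) comparison sequences `u(Qm)` of different total momenta differ by at most `(16U/15)²` times the modulus of the PARTIAL SUMS of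
their ladder net masses, so a `Qm`-modulus of the (E2-F2) net masses across the class converts the per-`Qm` statements of `PairVariationAtV17F` into `Qm`-uniform ones; the
edge clauses alone do not supply that modulus.  Everything is proved; no definitions; nothing about the model is asserted; nothing asserts superconductivity.
-/

noncomputable section

namespace Summit.HubbardSuperconductivity.HubbardSuperconductivity.Theorems.SWaveCascade

set_option linter.dupNamespace false -- summit = problem name (single-conjunct summit), D-0017

open Finset

section Scalar

variable {U U' W W' ν ν' : ℕ → ℝ} {N : ℕ}

/-- **Closed form of the cascade (reciprocals).**  If `U_0 > 0`, `U_{n+1} = U_n/(1 + W_n U_n)` and `0 < 1 + W_j U_j` for `j < n`, then `U_n > 0` and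
`U_n⁻¹ = U_0⁻¹ + Σ_{j<n} W_j`. -/
theorem sWaveCascade_inv_eq (h0 : 0 < U 0) (hU : ∀ n, U (n + 1) = U n / (1 + W n * U n)) {n : ℕ}
    (hden : ∀ j < n, 0 < 1 + W j * U j) : 0 < U n ∧ (U n)⁻¹ = (U 0)⁻¹ + ∑ j ∈ range n, W j := by
  induction n with
  | zero => exact ⟨h0, by simp⟩
  | succ n ih =>
    obtain ⟨hpos, hinv⟩ := ih fun j hj => hden j (Nat.lt_succ_of_lt hj)
    have hd := hden n (Nat.lt_succ_self n)
    refine ⟨by rw [hU n]; exact div_pos hpos hd, ?_⟩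
    rw [hU n, inv_div, sum_range_succ, ← add_assoc, ← hinv, add_div, one_div, mul_div_cancel_right₀ _ hpos.ne']

/-- **Closed form of the cascade.**  Under the hypotheses of `sWaveCascade_inv_eq`: `U_n = U_0/(1 + U_0·Σ_{j<n} W_j)` (and the denominator is positive). -/
theorem sWaveCascade_eq_div (h0 : 0 < U 0) (hU : ∀ n, U (n + 1) = U n / (1 + W n * U n)) {n : ℕ}
    (hden : ∀ j < n, 0 < 1 + W j * U j) :
    0 < 1 + U 0 * ∑ j ∈ range n, W j ∧ U n = U 0 / (1 + U 0 * ∑ j ∈ range n, W j) := by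
  obtain ⟨hpos, hinv⟩ := sWaveCascade_inv_eq h0 hU hden
  have hkey : (U n)⁻¹ * U 0 = 1 + U 0 * ∑ j ∈ range n, W j := by
    rw [hinv, add_mul, inv_mul_cancel₀ h0.ne', mul_comm]
  have hdpos : 0 < 1 + U 0 * ∑ j ∈ range n, W j := by rw [← hkey]; exact mul_pos (inv_pos.2 hpos) h0
  refine ⟨hdpos, ?_⟩
  rw [← hkey, mul_comm, ← div_div, div_self h0.ne', one_div, inv_inv]

/-- **Closed form under the negative-mass floor** (`…SWaveCascadeEdgeAlgebra`): `U_0 ≥ 0`, the law, `W ≥ −ν`, `ν ≥ 0`, `16·U_0·Σ_{j<N} ν_j ≤ 1` ⟹ for every `n ≤ N`,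
`U_n = U_0/(1 + U_0·Σ_{j<n} W_j)` with a positive denominator (the case `U_0 = 0` gives `U ≡ 0`). -/
theorem sWaveFloor_eq_div (h0 : 0 ≤ U 0) (hU : ∀ n, U (n + 1) = U n / (1 + W n * U n)) (hWν : ∀ n, -ν n ≤ W n)
    (hν0 : ∀ n, 0 ≤ ν n) (hsmall : 16 * U 0 * ∑ j ∈ range N, ν j ≤ 1) :
    ∀ n ≤ N, 0 < 1 + U 0 * ∑ j ∈ range n, W j ∧ U n = U 0 / (1 + U 0 * ∑ j ∈ range n, W j) := by
  intro n hn
  rcases h0.eq_or_lt with hz | hpos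
  · -- `U_0 = 0`: the cascade is identically zero
    have hzero : ∀ m, U m = 0 := by
      intro m
      induction m with
      | zero => exact hz.symm
      | succ m ih => rw [hU m, ih, zero_div]
    rw [hzero n, ← hz]
    simp
  · exact sWaveCascade_eq_div hpos hU fun j hj => (sWaveFloor_step h0 hU hWν hν0 hsmall j (lt_of_lt_of_le hj hn)).1

/-- **Exact comparison of two cascades from the same initial value**: under the floor hypotheses for both, for every `n ≤ N`,
`U_n − U'_n = U_n·U'_n·Σ_{j<n}(W'_j − W_j)`. -/
theorem sWaveFloor_sub_eq (h0 : 0 ≤ U 0) (h0' : U' 0 = U 0)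
    (hU : ∀ n, U (n + 1) = U n / (1 + W n * U n)) (hWν : ∀ n, -ν n ≤ W n) (hν0 : ∀ n, 0 ≤ ν n)
    (hsmall : 16 * U 0 * ∑ j ∈ range N, ν j ≤ 1)
    (hU' : ∀ n, U' (n + 1) = U' n / (1 + W' n * U' n)) (hWν' : ∀ n, -ν' n ≤ W' n) (hν0' : ∀ n, 0 ≤ ν' n)
    (hsmall' : 16 * U' 0 * ∑ j ∈ range N, ν' j ≤ 1) :
    ∀ n ≤ N, U n - U' n = U n * U' n * ∑ j ∈ range n, (W' j - W j) := by
  intro n hn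
  have h0'' : 0 ≤ U' 0 := by rw [h0']; exact h0
  obtain ⟨hd, he⟩ := sWaveFloor_eq_div h0 hU hWν hν0 hsmall n hn
  obtain ⟨hd', he'⟩ := sWaveFloor_eq_div h0'' hU' hWν' hν0' hsmall' n hn
  rw [h0'] at hd' he'
  rw [he, he', sum_sub_distrib]
  field_simp
  ring

/-- **Lipschitz dependence of the comparison sequence on the net masses**: under the floor hypotheses for both cascades (same `U_0 ≥ 0`), for every `n ≤ N`,
`|U_n − U'_n| ≤ (16U_0/15)²·|Σ_{j<n}(W_j − W'_j)|`. -/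
theorem sWaveFloor_sub_le (h0 : 0 ≤ U 0) (h0' : U' 0 = U 0)
    (hU : ∀ n, U (n + 1) = U n / (1 + W n * U n)) (hWν : ∀ n, -ν n ≤ W n) (hν0 : ∀ n, 0 ≤ ν n)
    (hsmall : 16 * U 0 * ∑ j ∈ range N, ν j ≤ 1)
    (hU' : ∀ n, U' (n + 1) = U' n / (1 + W' n * U' n)) (hWν' : ∀ n, -ν' n ≤ W' n) (hν0' : ∀ n, 0 ≤ ν' n)
    (hsmall' : 16 * U' 0 * ∑ j ∈ range N, ν' j ≤ 1) :
    ∀ n ≤ N, |U n - U' n| ≤ (16 / 15 * U 0) ^ 2 * |∑ j ∈ range n, (W j - W' j)| := by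
  intro n hn
  have h0'' : 0 ≤ U' 0 := by rw [h0']; exact h0
  obtain ⟨hUn, hUnle⟩ := sWaveFloor_bounds h0 hU hWν hν0 hsmall n hn
  obtain ⟨hUn', hUnle'⟩ := sWaveFloor_bounds h0'' hU' hWν' hν0' hsmall' n hn
  rw [h0'] at hUnle'
  rw [sWaveFloor_sub_eq h0 h0' hU hWν hν0 hsmall hU' hWν' hν0' hsmall' n hn, abs_mul, abs_mul, abs_of_nonneg hUn, abs_of_nonneg hUn',
    show ∑ j ∈ range n, (W' j - W j) = -∑ j ∈ range n, (W j - W' j) by rw [← sum_neg_distrib]; exact sum_congr rfl fun j _ => by ring,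
    abs_neg, sq]
  exact mul_le_mul_of_nonneg_right (mul_le_mul hUnle hUnle' hUn' (by positivity)) (abs_nonneg _)

/-- … hence `|U_n − U'_n| ≤ (16U_0/15)²·Σ_{j<n}|W_j − W'_j|`. -/
theorem sWaveFloor_sub_le' (h0 : 0 ≤ U 0) (h0' : U' 0 = U 0)
    (hU : ∀ n, U (n + 1) = U n / (1 + W n * U n)) (hWν : ∀ n, -ν n ≤ W n) (hν0 : ∀ n, 0 ≤ ν n)
    (hsmall : 16 * U 0 * ∑ j ∈ range N, ν j ≤ 1)
    (hU' : ∀ n, U' (n + 1) = U' n / (1 + W' n * U' n)) (hWν' : ∀ n, -ν' n ≤ W' n) (hν0' : ∀ n, 0 ≤ ν' n)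
    (hsmall' : 16 * U' 0 * ∑ j ∈ range N, ν' j ≤ 1) :
    ∀ n ≤ N, |U n - U' n| ≤ (16 / 15 * U 0) ^ 2 * ∑ j ∈ range n, |W j - W' j| := fun n hn =>
  (sWaveFloor_sub_le h0 h0' hU hWν hν0 hsmall hU' hWν' hν0' hsmall' n hn).trans
    (mul_le_mul_of_nonneg_left (abs_sum_le_sum_abs _ _) (sq_nonneg _))

end Scalar

end Summit.HubbardSuperconductivity.HubbardSuperconductivity.Theorems.SWaveCascade

end
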